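import Literature.NumberTheory.LFunctions.WeilFirstPrimeCertificateDataC
import HarnessLib

/-!
# First-prime Weil positivity, stage C: kernel check of the even scaled moments ν_48, ν_50, ν_52, ν_54, ν_56, ν_58

Part of `weilCert3C.check` (`WeilFirstPrimeCertificateDataC.lean`), evaluated by `decide +kernel` and kept in its own
file for kernel time and memory (each declaration is checked separately). Assembled in
`WeilFirstPrimeCertificateCCheck.lean`. Pure proof file; nothing is asserted.
-/

noncomputable section

namespace Literature.NumberTheory.LFunctions

set_option maxHeartbeats 0 in
/-- **Kernel check of the scaled moment `ν_{48}`** of the stage-C first-prime certificate. [folklore] -/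
theorem checkNuAt48_weilCert3C : weilCert3C.checkNuAt 48 = true := by
  decide +kernel

set_option maxHeartbeats 0 in
/-- **Kernel check of the scaled moment `ν_{50}`** of the stage-C first-prime certificate. [folklore] -/
theorem checkNuAt50_weilCert3C : weilCert3C.checkNuAt 50 = true := by
  decide +kernel

set_option maxHeartbeats 0 in
/-- **Kernel check of the scaled moment `ν_{52}`** of the stage-C first-prime certificate. [folklore] -/
theorem checkNuAt52_weilCert3C : weilCert3C.checkNuAt 52 = true := by
  decide +kernel

set_option maxHeartbeats 0 in
/-- **Kernel check of the scaled moment `ν_{54}`** of the stage-C first-prime certificate. [folklore] -/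
theorem checkNuAt54_weilCert3C : weilCert3C.checkNuAt 54 = true := by
  decide +kernel

set_option maxHeartbeats 0 in
/-- **Kernel check of the scaled moment `ν_{56}`** of the stage-C first-prime certificate. [folklore] -/
theorem checkNuAt56_weilCert3C : weilCert3C.checkNuAt 56 = true := by
  decide +kernel

set_option maxHeartbeats 0 in
/-- **Kernel check of the scaled moment `ν_{58}`** of the stage-C first-prime certificate. [folklore] -/
theorem checkNuAt58_weilCert3C : weilCert3C.checkNuAt 58 = true := by
  decide +kernel

end Literature.NumberTheory.LFunctions
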